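import Summits.ABC.IUTFork.Joshi.ATS4LogDiffConductor
import Literature.NumberTheory.NumberFields.RelativeDifferentExponents
import Literature.IUT.LogVolume.DifferentDivisorTower
import HarnessLib

/-!
# Joshi, *Arithmetic Teichmüller Spaces IV* (arXiv:2403.10430v2) Thm. 4.6.1, eq. (4.6.4): «τ_{w|v} = 0 iff w|v is tamely
# ramified» and the Galois-case upper bound — PROVED over Mathlib number fields

Proof-only companion of `Joshi/ATS4LogDiffConductor.lean` (abc-iut cell, branch E, rung LADDER-ABC:A2.E; seat abc-iut-E-t27,
slot T-27). **No side is taken** on [IUTchIII] Cor. 3.12, on Joshi's claims, or on Mochizuki's reports on them; the source is an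
unrefereed arXiv preprint. Locators «p.N l.M» refer to the render `HOME/lit/renders/Joshi-arxiv-2403.10430/` (v2).

The typed claim `LogDiffCond.TauBounds L M` ([J-IV] (4.6.4) p.47 l.20–24 / Thm. 4.6.1 (1) p.46 l.34–35, [Bombieri–Gubler 2006,
B.2.12]) has two conjuncts per prime `w` of `M`: (a) `τ_{w|v} = 0 ↔ w|v tamely ramified`; (b) `w|v` wild `⇒ 1 ≤ τ_{w|v} ≤
e_{w|v}·ord_v(e_{w|v})`. Here, for EVERY extension of number fields `M/L`:

* `tau_eq_zero_iff_isTameAt` — **conjunct (a) PROVED** (`tauBounds_first`), from Serre, *Corps locaux* III §6 Prop. 13 in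
  the tree (`Literature.NumberTheory.NumberFields.multiplicity_differentIdeal_eq_of_not_dvd` for the tame direction and the
  wild direction `ramificationIdx_le_multiplicity_differentIdeal_of_dvd` proved below from the tree's
  `pow_dvd_differentIdeal_of_natCast_ramificationIdx_mem`: `p_w ∣ e ⇒ w^e ∣ 𝔡_{M/L}`);
* `one_le_tau_of_not_isTameAt` — the lower half of (b), `w|v` wild `⇒ 1 ≤ τ_{w|v}`, PROVED;
* `tau_le_ordIdeal_span_of_isGalois` — the upper half of (b) in the GALOIS case: `τ_{w|v} ≤ ord_w((e_{w|v}))` (the exponent of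
  `w` in the principal ideal `(e_{w|v})·𝓞_M`; the tree's [Bombieri–Gubler 2006, B.2.11] `multiplicity_differentIdeal_succ_le_
  of_isGalois`); since `(e)·𝓞_M` is extended from `(e)·𝓞_L`, `ord_w((e)) = e_{w|v}·ord_v((e))` is Joshi's bound in the Galois
  case. The general (non-Galois) upper bound of B.2.12 / Hensel is not packaged for number fields in the tree (its DVR form is
  `Literature.NumberTheory.NumberFields.HenselDifferentBound`) and stays the typed hypothesis.

Glue (private here; the public versions live in `Joshi/ATS4LogDiffConductorIdentity.lean`): `relRamIdx` = Mathlib's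
`Ideal.ramificationIdx` over `𝓞_L`, `relDiffExp`/`ordIdeal` = Mathlib's `multiplicity`, `residueChar` (`ringChar (𝓞 M ⧸ w)`) =
`N(w ∩ ℤ)`. Theorems only; standard axioms; no `sorry`, instance, notation or new `Prop` fact.
[claim: Joshi2024ATS4, status: disputed] (provenance of the typed items; nothing endorsed).
-/

noncomputable section

namespace Summit.ABC.IUTFork.Joshi.ATS4

namespace LogDiffCond

open NumberField IsDedekindDomain Ideal Module UniqueFactorizationMonoid
open Literature.NumberTheory.NumberFields (ramificationIdx_sub_one_le_multiplicity_differentIdeal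
  multiplicity_differentIdeal_eq_of_not_dvd multiplicity_differentIdeal_succ_le_of_isGalois natCast_mem_iff_absNorm_under_dvd
  natCast_mem_under_iff pow_dvd_differentIdeal_of_natCast_ramificationIdx_mem)

variable (L M : Type*) [Field L] [NumberField L] [Field M] [NumberField M] [Algebra L M]

/-! ### The wild direction of Serre III §6 Prop. 13 for number fields -/

/-- **Wild case: `p_w ∣ e ⇒ e ≤ ord_w 𝔡_{M/L}`** (`w^e ∣ 𝔡_{M/L}`) for a maximal ideal `w` of `𝓞_M`, `e = e(w | w ∩ 𝓞_L)`, `p_w` the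
residue characteristic — the tree's `pow_dvd_differentIdeal_of_natCast_ramificationIdx_mem` (Serre III §6 Prop. 13, wild
direction) specialised to rings of integers, with the factorisation `(w ∩ 𝓞_L)·𝓞_M = w^e·I`, `w + I = 𝓞_M` from Mathlib's
`Ideal.eq_prime_pow_mul_coprime` and the finite residue field of `w ∩ 𝓞_L`. [cite: BombieriGubler2006, Thm B.2.12] -/
theorem ramificationIdx_le_multiplicity_differentIdeal_of_dvd (P : Ideal (𝓞 M)) [P.IsMaximal]
    (hwild : Ideal.absNorm (P.under ℤ) ∣ P.ramificationIdx (𝓞 L)) :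
    P.ramificationIdx (𝓞 L) ≤ multiplicity P (differentIdeal (𝓞 L) (𝓞 M)) := by
  classical
  have hP : P ≠ ⊥ := Ideal.IsMaximal.ne_bot_of_isIntegral_int P
  set p := P.under (𝓞 L) with hpdef
  have hp : p ≠ ⊥ := under_ne_bot (𝓞 L) hP
  haveI : p.IsMaximal := IsMaximal.under (𝓞 L) P
  have hp' : p.map (algebraMap (𝓞 L) (𝓞 M)) ≠ ⊥ := map_ne_bot_of_ne_bot hp
  set e := P.ramificationIdx (𝓞 L) with hedef
  have he0 : e ≠ 0 := (Ideal.ramificationIdx_pos P (𝓞 L)).ne'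
  obtain ⟨I, hcop, hfac⟩ := Ideal.eq_prime_pow_mul_coprime hp' P
  rw [← IsDedekindDomain.ramificationIdx_eq_normalizedFactors_count p P hp'] at hfac
  haveI : (P ^ e).LiesOver p := by
    constructor
    refine le_antisymm ?_ ?_
    · rw [← Ideal.map_le_iff_le_comap, hfac]; exact Ideal.mul_le_right
    · calc (P ^ e).under (𝓞 L) ≤ P.under (𝓞 L) := Ideal.comap_mono (Ideal.pow_le_self he0)
        _ = p := rfl
  letI := Ideal.Quotient.field p
  letI := Ideal.Quotient.field P
  haveI : Finite (𝓞 L ⧸ p) := Ideal.finiteQuotientOfFreeOfNeBot p hp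
  haveI : Algebra.IsAlgebraic (𝓞 L ⧸ p) (𝓞 M ⧸ P) := Algebra.IsAlgebraic.of_finite _ _
  have key := pow_dvd_differentIdeal_of_natCast_ramificationIdx_mem (𝓞 L) L M (𝓞 M) hp P he0 hfac hcop
    (by rwa [natCast_mem_under_iff])
  have hD : differentIdeal (𝓞 L) (𝓞 M) ≠ ⊥ := differentIdeal_ne_bot
  exact (FiniteMultiplicity.of_prime_left (prime_of_isPrime hP inferInstance) hD).le_multiplicity_of_pow_dvd key

/-- **Serre III §6 Prop. 13 for number fields, exponent form**: `ord_w 𝔡_{M/L} = e − 1 ↔ p_w ∤ e`.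
[cite: BombieriGubler2006, Thm B.2.12] -/
theorem multiplicity_differentIdeal_eq_sub_one_iff (P : Ideal (𝓞 M)) [P.IsMaximal] :
    multiplicity P (differentIdeal (𝓞 L) (𝓞 M)) = P.ramificationIdx (𝓞 L) - 1 ↔
      ¬ Ideal.absNorm (P.under ℤ) ∣ P.ramificationIdx (𝓞 L) := by
  refine ⟨fun h hdvd => ?_, multiplicity_differentIdeal_eq_of_not_dvd L M P⟩
  have h1 := ramificationIdx_le_multiplicity_differentIdeal_of_dvd L M P hdvd
  have h2 := Ideal.ramificationIdx_pos P (𝓞 L)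
  omega

/-! ### Glue to the typed §4.6 quantities (private copies; public ones in `ATS4LogDiffConductorIdentity`) -/

omit [NumberField L] in
/-- `e_{w|v}`: Mathlib `ramificationIdx'` over `w ∩ 𝓞_L` = `Ideal.ramificationIdx` over `𝓞_L` (private copy). [folklore] -/
private theorem relRamIdx_eq' (w : HeightOneSpectrum (𝓞 M)) : relRamIdx L M w = w.asIdeal.ramificationIdx (𝓞 L) := by
  haveI := w.isPrime
  exact Ideal.ramificationIdx'_eq_ramificationIdx (w.asIdeal.under (𝓞 L)) w.asIdeal (w.under (𝓞 L)).ne_bot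

/-- `d_{w|v}`: `Associates.count` = `multiplicity` for `𝔡_{M/L}` (private copy). [folklore] -/
private theorem relDiffExp_eq_multiplicity' (w : HeightOneSpectrum (𝓞 M)) :
    relDiffExp L M w = multiplicity w.asIdeal (differentIdeal (𝓞 L) (𝓞 M)) := by
  classical
  have hI : differentIdeal (𝓞 L) (𝓞 M) ≠ ⊥ := differentIdeal_ne_bot
  rw [relDiffExp, ordIdeal, Ideal.count_associates_factors_eq hI w.isPrime w.ne_bot,
    UniqueFactorizationMonoid.multiplicity_eq_count_normalizedFactors w.irreducible hI, normalize_eq]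

omit [NumberField L] [NumberField M] [Algebra L M] in
/-- `ringChar (𝓞 M ⧸ w) = N(w ∩ ℤ)`, the residue characteristic (private copy). [folklore] -/
private theorem residueChar_eq' (w : HeightOneSpectrum (𝓞 M)) :
    LogDiffCond.residueChar M w = Ideal.absNorm (w.asIdeal.under ℤ) := by
  haveI : NeZero w.asIdeal := ⟨w.ne_bot⟩
  haveI := w.isPrime
  have hprime : (Ideal.absNorm (w.asIdeal.under ℤ)).Prime := Nat.absNorm_under_prime w.asIdeal
  have hmem : ((Ideal.absNorm (w.asIdeal.under ℤ) : ℕ) : 𝓞 M) ∈ w.asIdeal :=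
    (natCast_mem_iff_absNorm_under_dvd M w.asIdeal _).mpr dvd_rfl
  haveI : Nontrivial (𝓞 M ⧸ w.asIdeal) := Ideal.Quotient.nontrivial_iff.mpr w.isPrime.ne_top
  refine CharP.ringChar_of_prime_eq_zero hprime ?_
  rw [← map_natCast (Ideal.Quotient.mk w.asIdeal), Ideal.Quotient.eq_zero_iff_mem]
  exact hmem

omit [NumberField L] in
/-- `IsTameAt` in the tree's terms: `p_w ∤ e(w | w ∩ 𝓞_L)` (private copy). [folklore] -/
private theorem isTameAt_iff' (w : HeightOneSpectrum (𝓞 M)) :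
    IsTameAt L M w ↔ ¬ Ideal.absNorm (w.asIdeal.under ℤ) ∣ w.asIdeal.ramificationIdx (𝓞 L) := by
  rw [IsTameAt, residueChar_eq', relRamIdx_eq']

/-! ### (4.6.4): `τ = 0 ↔ tame`, and the wild lower bound -/

/-- **[J-IV] (4.6.4) / Thm. 4.6.1 (1), first clause — PROVED**: «τ_{w|v} = 0 if and only if w|v is at worst tamely ramified»
(p.46 l.34, p.47 l.20–24), for every prime `w` of every extension of number fields `M/L`, with the typed
`τ_{w|v} = ord_w 𝔡_{M/L} − (e_{w|v} − 1)`. [cite: BombieriGubler2006, Thm B.2.12] -/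
theorem tau_eq_zero_iff_isTameAt (w : HeightOneSpectrum (𝓞 M)) : tau L M w = 0 ↔ IsTameAt L M w := by
  haveI := w.isMaximal
  have hge := ramificationIdx_sub_one_le_multiplicity_differentIdeal L M w.asIdeal
  rw [isTameAt_iff', ← multiplicity_differentIdeal_eq_sub_one_iff L M w.asIdeal, tau, relDiffExp_eq_multiplicity',
    relRamIdx_eq']
  omega

/-- **[J-IV] (4.6.4), wild lower bound — PROVED**: if `w|v` is wildly ramified then `1 ≤ τ_{w|v}` («[1, e_{w|v}·ord_v(e_{w|v})] ⊂ ℕ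
if w|v is wildly ramified», p.47 l.24; lower end). [cite: BombieriGubler2006, Thm B.2.12] -/
theorem one_le_tau_of_not_isTameAt (w : HeightOneSpectrum (𝓞 M)) (hw : ¬ IsTameAt L M w) : 1 ≤ tau L M w := by
  have h : tau L M w ≠ 0 := fun h0 => hw ((tau_eq_zero_iff_isTameAt L M w).mp h0)
  omega

/-- The first conjunct of the typed `TauBounds`, for every prime: `τ_{w|v} = 0 ↔ IsTameAt`, and the lower half of the second.
PROVED. [cite: BombieriGubler2006, Thm B.2.12] -/
theorem tauBounds_first (w : HeightOneSpectrum (𝓞 M)) :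
    (tau L M w = 0 ↔ IsTameAt L M w) ∧ (¬ IsTameAt L M w → 1 ≤ tau L M w) :=
  ⟨tau_eq_zero_iff_isTameAt L M w, one_le_tau_of_not_isTameAt L M w⟩

/-! ### The Galois-case upper bound -/

/-- **[J-IV] (4.6.4), upper bound, GALOIS case — PROVED**: for `M/L` Galois and every prime `w` of `M`,
`τ_{w|v} ≤ ord_w((e_{w|v})·𝓞_M)` (Dedekind's different theorem in the form [Bombieri–Gubler 2006, B.2.11], the tree's
`multiplicity_differentIdeal_succ_le_of_isGalois`: `ord_w 𝔡_{M/L} ≤ e − 1 + ord_w((e))`). Since `(e)·𝓞_M` is the extension of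
`(e)·𝓞_L`, `ord_w((e)·𝓞_M) = e_{w|v}·ord_v((e)·𝓞_L)`, i.e. Joshi's printed range `τ_{w|v} ≤ e_{w|v}·ord_v(e_{w|v})` in this case;
the general (non-Galois) case is B.2.12 and stays the typed hypothesis `TauBounds`. [cite: BombieriGubler2006, Thm B.2.11] -/
theorem tau_le_ordIdeal_span_of_isGalois [IsGalois L M] (w : HeightOneSpectrum (𝓞 M)) :
    tau L M w ≤ ordIdeal w (Ideal.span {((relRamIdx L M w : ℕ) : 𝓞 M)}) := by
  classical
  haveI := w.isMaximal
  have h := multiplicity_differentIdeal_succ_le_of_isGalois L M w.asIdeal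
  have he0 : w.asIdeal.ramificationIdx (𝓞 L) ≠ 0 := (Ideal.ramificationIdx_pos w.asIdeal (𝓞 L)).ne'
  have hspan : Ideal.span {((w.asIdeal.ramificationIdx (𝓞 L) : ℕ) : 𝓞 M)} ≠ ⊥ := by
    rw [Ne, Ideal.span_singleton_eq_bot, Nat.cast_eq_zero]; exact he0
  have hord : ordIdeal w (Ideal.span {((relRamIdx L M w : ℕ) : 𝓞 M)}) =
      multiplicity w.asIdeal (Ideal.span {((w.asIdeal.ramificationIdx (𝓞 L) : ℕ) : 𝓞 M)}) := by
    rw [relRamIdx_eq', ordIdeal, Ideal.count_associates_factors_eq hspan w.isPrime w.ne_bot,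
      UniqueFactorizationMonoid.multiplicity_eq_count_normalizedFactors w.irreducible hspan, normalize_eq]
  rw [hord, tau, relDiffExp_eq_multiplicity', relRamIdx_eq']
  omega

end LogDiffCond

end Summit.ABC.IUTFork.Joshi.ATS4

end
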